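import Summits.CriticalPhenomena.PercolationContinuityZ3.Theorems.PercNearOneGluingNoHeavyQuantWindowExtremeShape
import Summits.CriticalPhenomena.PercolationContinuityZ3.Theorems.PercNearOneGluingNoHeavyQuantAtomLightSlice
import Summits.CriticalPhenomena.PercolationContinuityZ3.Theorems.PercNearOneGluingNoHeavyQuantAtomOrder
import Summits.CriticalPhenomena.PercolationContinuityZ3.Theorems.PercNearOneGluingNoHeavyQuantAtomLawOrdered
import Summits.CriticalPhenomena.PercolationContinuityZ3.Theorems.PercNearOneGluingNoHeavyQuantConvSingleLow
import HarnessLib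

/-!
# QUANT lane R8, T-DEC: **`ConvClosedT ⟸ ConvClosedTAtomsOrd`** — the convolution closure of window-DEC laws reduces to its EXPLICIT, ORDERED atom ⊗ atom
# residue (census-2 g58): Krein–Milman on the window polytope with the structure theorem `windowExtreme_shapeOrd`, bilinearity, census-1 g20's
# single-low closure and one-sided theorem, (O1); hence `FarTreeRow ⟸ ConvClosedTAtomsOrd ∧ GatedConvEmptyFree`

builds on p205010 (kernel theorem, internal audit signed; external expert review pending)

Support file (`--supports stmt-CriticalPhenomena-4575`), QUANT lane seat prim-quant-census-2 (gen 58), rung R8 of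
`run/shared/lean/prim/quant/LADDER.md`.  Theorems only, standard axioms, no sorries.  Memo `…/prim-quant-census-2-g58/EXTREME-ATOMS-G58.md` §2.

THE REDUCTION.  (1) `windowShapeDecomposition`: every window-DEC probability law on `{0..M}` is a finite mixture of window-DEC probability laws
of known SHAPE (`ExtremeShape`: at most one low of the top layer, or a balanced two-segment atom `atomLaw`) — g57's Krein–Milman/Carathéodory
argument (`windowAtomDecomposition_of_extremeSmall`) with `windowExtreme_shapeOrd` and the closedness of the shape set in coordinates (a finite union of
coordinate subspaces and points).  (2) `lconv_decAtT_of_shapes`: one cross term — a factor with at most one low by `lconv_decAtT_of_window_singleLow`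
(census-1 g20; commuted for the first factor), a factor with a datum without light straddlers by the one-sided theorem
(`lconv_decAtT_of_window_bdecAtT'` / `lconv_decAtT_of_bdecAtT_window'`), two atoms without such data by `ConvClosedTAtomsOrd` — their
cheap segments straddle (`straddle_of_not_bdecAtT`), so (O1) `not_parallel_of_window` leaves only the crossed staircase order.  (3) bilinearity
(`lconv_decAtT_of_mixtures`, census-2 g56).

* **`LawDec.windowExtreme_shapeOrd`** / `windowExtreme_shape` — the structure theorem assembled from the three cases (`…QuantWindowExtremeLaw`,
  `…QuantWindowExtremeShape`): at most one low of layer `j`, or `atomLaw` of admissible data in staircase order.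
* `LawDec.isClosed_shapeVecSet`, `shapeVec_of_shape`, `shape_of_shapeVec`, **`LawDec.windowShapeDecomposition`**, `LawDec.lconv_decAtT_of_shapes`.
* **`LawDec.convClosedT_of_atomPairsOrd : ConvClosedTAtomsOrd → ConvClosedT`**, `convClosedT_of_atomPairs : ConvClosedTAtoms → ConvClosedT`;
  `sdecConvClosed_of_atomPairs(Ord)`, `treeBuiltDEC_of_atomPairs`, `Quant.treeDEC_of_atomPairs`, **`Quant.farTreeRow_of_atomPairsOrd :
  ConvClosedTAtomsOrd → GatedConvEmptyFree → FarTreeRow`**, `Quant.farTreeRow_of_atomPairs` (CONDITIONAL: the hypotheses are `@[conjecture]`).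
* `LawDec.convClosedTAtoms_of_residue : ConvClosedTResidue → ConvClosedTAtoms` (the new statement is implied by the old one: atoms are small laws).

HONEST STATUS: `ConvClosedTAtomsOrd` / `ConvClosedTAtoms` (II, explicit forms), `GatedConvEmptyFree` (III), hence `ConvClosedT`, `SDECConvClosed`, `TreeBuiltDEC`, `TreeDEC`,
`FarTreeRow` remain OPEN.  [this work]; nothing here is cited as a published result.  The gluing rows served [cite: KozmaNitzan2024, Conjecture 3 (p. 15)]; product
measure [cite: Grimmett1999, §1.3 p. 10].
-/

noncomputable section

namespace Summit.CriticalPhenomena.PercolationContinuityZ3.Theorems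

namespace Quant

open Finset

namespace LawDec

/-! ### The structure theorem assembled -/

/-- **THE STRUCTURE OF THE EXTREME POINTS OF THE WINDOW POLYTOPE** (census-2 g58; refines census-2 g57's `windowExtremeSmall_holds`):
for a floor `0 < x < 1`, every extreme point of `windowSet x T M j w` either charges AT MOST ONE low of the layer `j`, or IS the balanced
two-segment atom `atomLaw x T j l₁ h₁ l₂ h₂` of admissible data (`AtomData`: two credit-tight segments from distinct lows to compatible mids
`≤ j`, rates `c₂ < x/(1−x) < c₁`, low masses `(u − c₂) : (c₁ − u)` — census-2 g56's Type I/II closed forms with the all-giant balance).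
[this work] -/
theorem windowExtreme_shapeOrd (x T : ℝ) (M j w : ℕ) (v : Fin (M + 1) → ℝ) (hx0 : 0 < x) (hx1 : x < 1)
    (hvext : v ∈ (windowSet x T M j w).extremePoints ℝ) :
    (∃ q, q ≤ j ∧ ∀ k, k ≤ j → 2 * (k : ℝ) < T → vecLaw M v k ≠ 0 → k = q) ∨
    (∃ l₁ h₁ l₂ h₂, AtomData x T j M l₁ h₁ l₂ h₂ ∧ ((l₁ < l₂ ∧ h₂ ≤ h₁) ∨ (l₂ < l₁ ∧ h₁ ≤ h₂)) ∧
      ∀ b, vecLaw M v b = atomLaw x T j l₁ h₁ l₂ h₂ b) := by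
  classical
  set Tgt : Finset ℕ := (Finset.range (j + 1)).filter (fun J => j ≤ J + w ∧
      (∀ l, J < l → l ≤ j → 2 * (l : ℝ) < T → vecLaw M v l = 0) ∧
      x / (1 - x) * windowS x T j M (vecLaw M v) J = ∑ h ∈ Finset.Ico (J + 1) (M + 1), vecLaw M v h ∧
      0 < ∑ h ∈ Finset.Ico (J + 1) (M + 1), vecLaw M v h) with hTgt
  by_cases hne : Tgt.Nonempty
  · have hJs : Tgt.max' hne ∈ Tgt := Finset.max'_mem _ _
    obtain ⟨-, -, hgap, hS, hΓ⟩ := Finset.mem_filter.1 hJs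
    have hmax : ∀ J, J ≤ j → j ≤ J + w → (∀ l, J < l → l ≤ j → 2 * (l : ℝ) < T → vecLaw M v l = 0) →
        x / (1 - x) * windowS x T j M (vecLaw M v) J = ∑ h ∈ Finset.Ico (J + 1) (M + 1), vecLaw M v h →
        0 < ∑ h ∈ Finset.Ico (J + 1) (M + 1), vecLaw M v h → J ≤ Tgt.max' hne :=
      fun J h1 h2 h3 h4 h5 =>
        Finset.le_max' _ _ (Finset.mem_filter.2 ⟨Finset.mem_range.2 (Nat.lt_succ_of_le h1), h2, h3, h4, h5⟩)
    by_cases hgiant : ∃ g, j < g ∧ g ≤ M ∧ vecLaw M v g ≠ 0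
    · obtain ⟨g, hjg, hgM, hgne⟩ := hgiant
      exact Or.inl (atMostOneLow_of_tight_giant x T M j w v hx0 hx1 hvext (Tgt.max' hne) hS hΓ hmax g hjg hgM hgne)
    · push Not at hgiant
      exact shape_of_tight_noGiant x T M j w v hx0 hx1 hvext (Tgt.max' hne) hgap hS hΓ hmax hgiant
  · have hno : ∀ J, J ≤ j → j ≤ J + w → (∀ l, J < l → l ≤ j → 2 * (l : ℝ) < T → vecLaw M v l = 0) →
        x / (1 - x) * windowS x T j M (vecLaw M v) J = ∑ h ∈ Finset.Ico (J + 1) (M + 1), vecLaw M v h →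
        0 < ∑ h ∈ Finset.Ico (J + 1) (M + 1), vecLaw M v h → False :=
      fun J h1 h2 h3 h4 h5 => hne ⟨J, Finset.mem_filter.2 ⟨Finset.mem_range.2 (Nat.lt_succ_of_le h1), h2, h3, h4, h5⟩⟩
    exact Or.inl (atMostOneLow_of_noTight x T M j w v hx0 hx1 hvext hno)



/-- **THE STRUCTURE OF THE EXTREME POINTS, `ExtremeShape` form** (without the staircase fact). [this work] -/
theorem windowExtreme_shape (x T : ℝ) (M j w : ℕ) (v : Fin (M + 1) → ℝ) (hx0 : 0 < x) (hx1 : x < 1)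
    (hvext : v ∈ (windowSet x T M j w).extremePoints ℝ) : ExtremeShape x T j M (vecLaw M v) := by
  rcases windowExtreme_shapeOrd x T M j w v hx0 hx1 hvext with h | ⟨l₁, h₁, l₂, h₂, hd, -, hv⟩
  · exact Or.inl h
  · exact Or.inr ⟨l₁, h₁, l₂, h₂, hd, hv⟩


/-! ### The shape set in coordinates -/

section Reduction

/-- the coordinate shape set is closed (a finite union of coordinate subspaces and of single points). [this work] -/
theorem isClosed_shapeVecSet (x T : ℝ) (M j : ℕ) :
    IsClosed {v : Fin (M + 1) → ℝ | (∃ q : Fin (j + 1), ∀ k : Fin (M + 1), (k : ℕ) ≤ j → 2 * ((k : ℕ) : ℝ) < T → v k ≠ 0 → (k : ℕ) = q) ∨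
      (∃ l₁ h₁ l₂ h₂ : Fin (M + 1), (AtomData x T j M l₁ h₁ l₂ h₂ ∧ ((l₁ < l₂ ∧ h₂ ≤ h₁) ∨ (l₂ < l₁ ∧ h₁ ≤ h₂))) ∧
        ∀ k : Fin (M + 1), v k = atomLaw x T j l₁ h₁ l₂ h₂ k)} := by
  have e : {v : Fin (M + 1) → ℝ | (∃ q : Fin (j + 1), ∀ k : Fin (M + 1), (k : ℕ) ≤ j → 2 * ((k : ℕ) : ℝ) < T → v k ≠ 0 → (k : ℕ) = q) ∨
      (∃ l₁ h₁ l₂ h₂ : Fin (M + 1), (AtomData x T j M l₁ h₁ l₂ h₂ ∧ ((l₁ < l₂ ∧ h₂ ≤ h₁) ∨ (l₂ < l₁ ∧ h₁ ≤ h₂))) ∧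
        ∀ k : Fin (M + 1), v k = atomLaw x T j l₁ h₁ l₂ h₂ k)} =
      (⋃ q : Fin (j + 1), ⋂ k : Fin (M + 1), {v : Fin (M + 1) → ℝ | ((k : ℕ) ≤ j ∧ 2 * ((k : ℕ) : ℝ) < T ∧ (k : ℕ) ≠ q) → v k = 0}) ∪
      (⋃ (l₁ : Fin (M + 1)) (h₁ : Fin (M + 1)) (l₂ : Fin (M + 1)) (h₂ : Fin (M + 1)),
        {v | (AtomData x T j M l₁ h₁ l₂ h₂ ∧ ((l₁ < l₂ ∧ h₂ ≤ h₁) ∨ (l₂ < l₁ ∧ h₁ ≤ h₂))) ∧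
          ∀ k : Fin (M + 1), v k = atomLaw x T j l₁ h₁ l₂ h₂ k}) := by
    ext v
    simp only [Set.mem_setOf_eq, Set.mem_union, Set.mem_iUnion, Set.mem_iInter, ne_eq]
    constructor
    · rintro (⟨q, hq⟩ | ⟨l₁, h₁, l₂, h₂, hd, hv⟩)
      · exact Or.inl ⟨q, fun k hk => by_contra fun hne => hk.2.2 (hq k hk.1 hk.2.1 hne)⟩
      · exact Or.inr ⟨l₁, h₁, l₂, h₂, hd, hv⟩
    · rintro (⟨q, hq⟩ | ⟨l₁, h₁, l₂, h₂, hd, hv⟩)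
      · exact Or.inl ⟨q, fun k hk1 hk2 hne => by_contra fun hkq => hne (hq k ⟨hk1, hk2, hkq⟩)⟩
      · exact Or.inr ⟨l₁, h₁, l₂, h₂, hd, hv⟩
  rw [e]
  refine IsClosed.union (isClosed_iUnion_of_finite fun q => isClosed_iInter fun k => ?_)
    (isClosed_iUnion_of_finite fun l₁ => isClosed_iUnion_of_finite fun h₁ => isClosed_iUnion_of_finite fun l₂ =>
      isClosed_iUnion_of_finite fun h₂ => ?_)
  · by_cases hp : (k : ℕ) ≤ j ∧ 2 * ((k : ℕ) : ℝ) < T ∧ (k : ℕ) ≠ q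
    · have : {v : Fin (M + 1) → ℝ | ((k : ℕ) ≤ j ∧ 2 * ((k : ℕ) : ℝ) < T ∧ (k : ℕ) ≠ q) → v k = 0} = {v | v k = 0} := by
        ext v; simp only [Set.mem_setOf_eq]; exact ⟨fun h => h hp, fun h _ => h⟩
      rw [this]; exact isClosed_eq (continuous_apply k) continuous_const
    · have : {v : Fin (M + 1) → ℝ | ((k : ℕ) ≤ j ∧ 2 * ((k : ℕ) : ℝ) < T ∧ (k : ℕ) ≠ q) → v k = 0} = Set.univ :=
        Set.eq_univ_of_forall fun _ h => absurd h hp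
      rw [this]; exact isClosed_univ
  · by_cases hp : AtomData x T j M l₁ h₁ l₂ h₂ ∧ ((l₁ < l₂ ∧ h₂ ≤ h₁) ∨ (l₂ < l₁ ∧ h₁ ≤ h₂))
    · have : {v : Fin (M + 1) → ℝ | (AtomData x T j M l₁ h₁ l₂ h₂ ∧ ((l₁ < l₂ ∧ h₂ ≤ h₁) ∨ (l₂ < l₁ ∧ h₁ ≤ h₂))) ∧
          ∀ k : Fin (M + 1), v k = atomLaw x T j l₁ h₁ l₂ h₂ k}
          = ⋂ k : Fin (M + 1), {v | v k = atomLaw x T j l₁ h₁ l₂ h₂ k} := by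
        ext v; simp only [Set.mem_setOf_eq, Set.mem_iInter]; exact ⟨fun h => h.2, fun h => ⟨hp, h⟩⟩
      rw [this]; exact isClosed_iInter fun k => isClosed_eq (continuous_apply k) continuous_const
    · have : {v : Fin (M + 1) → ℝ | (AtomData x T j M l₁ h₁ l₂ h₂ ∧ ((l₁ < l₂ ∧ h₂ ≤ h₁) ∨ (l₂ < l₁ ∧ h₁ ≤ h₂))) ∧
          ∀ k : Fin (M + 1), v k = atomLaw x T j l₁ h₁ l₂ h₂ k} = ∅ :=
        Set.eq_empty_of_forall_notMem fun _ hv => hp hv.1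
      rw [this]; exact isClosed_empty

/-- from `ExtremeShape` of the carried law to the coordinate form. [this work] -/
theorem shapeVec_of_shape {x T : ℝ} {M j : ℕ} {v : Fin (M + 1) → ℝ}
    (hs : ((∃ q, q ≤ j ∧ ∀ k, k ≤ j → 2 * (k : ℝ) < T → vecLaw M v k ≠ 0 → k = q) ∨
      (∃ l₁ h₁ l₂ h₂, AtomData x T j M l₁ h₁ l₂ h₂ ∧ ((l₁ < l₂ ∧ h₂ ≤ h₁) ∨ (l₂ < l₁ ∧ h₁ ≤ h₂)) ∧
        ∀ b, vecLaw M v b = atomLaw x T j l₁ h₁ l₂ h₂ b))) :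
    v ∈ {v : Fin (M + 1) → ℝ | (∃ q : Fin (j + 1), ∀ k : Fin (M + 1), (k : ℕ) ≤ j → 2 * ((k : ℕ) : ℝ) < T → v k ≠ 0 → (k : ℕ) = q) ∨
      (∃ l₁ h₁ l₂ h₂ : Fin (M + 1), (AtomData x T j M l₁ h₁ l₂ h₂ ∧ ((l₁ < l₂ ∧ h₂ ≤ h₁) ∨ (l₂ < l₁ ∧ h₁ ≤ h₂))) ∧
        ∀ k : Fin (M + 1), v k = atomLaw x T j l₁ h₁ l₂ h₂ k)} := by
  rcases hs with ⟨q, hqj, hq⟩ | ⟨l₁, h₁, l₂, h₂, hd, hv⟩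
  swap
  · have hd : AtomData x T j M l₁ h₁ l₂ h₂ ∧ ((l₁ < l₂ ∧ h₂ ≤ h₁) ∨ (l₂ < l₁ ∧ h₁ ≤ h₂)) := ⟨hd, hv.1⟩
    have hv := hv.2
    obtain ⟨hd, hord⟩ := hd
    obtain ⟨hl1, hl2⟩ := hd.lt_of
    have hd' := hd
    obtain ⟨-, -, -, a4, -, -, -, -, b4, -, -⟩ := hd'
    refine Or.inr ⟨⟨l₁, by omega⟩, ⟨h₁, by omega⟩, ⟨l₂, by omega⟩, ⟨h₂, by omega⟩, ⟨hd, hord⟩, fun k => ?_⟩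
    rw [← vecLaw_fin v k]; exact hv k
  · refine Or.inl ⟨⟨q, Nat.lt_succ_of_le hqj⟩, fun k hk1 hk2 hne => ?_⟩
    exact hq k hk1 hk2 (by rwa [vecLaw_fin])

/-- from the coordinate form back to `ExtremeShape` of the carried law. [this work] -/
theorem shape_of_shapeVec {x T : ℝ} {M j : ℕ} {v : Fin (M + 1) → ℝ}
    (hs : v ∈ {v : Fin (M + 1) → ℝ | (∃ q : Fin (j + 1), ∀ k : Fin (M + 1), (k : ℕ) ≤ j → 2 * ((k : ℕ) : ℝ) < T → v k ≠ 0 → (k : ℕ) = q) ∨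
      (∃ l₁ h₁ l₂ h₂ : Fin (M + 1), (AtomData x T j M l₁ h₁ l₂ h₂ ∧ ((l₁ < l₂ ∧ h₂ ≤ h₁) ∨ (l₂ < l₁ ∧ h₁ ≤ h₂))) ∧
        ∀ k : Fin (M + 1), v k = atomLaw x T j l₁ h₁ l₂ h₂ k)}) :
    ((∃ q, q ≤ j ∧ ∀ k, k ≤ j → 2 * (k : ℝ) < T → vecLaw M v k ≠ 0 → k = q) ∨
      (∃ l₁ h₁ l₂ h₂, AtomData x T j M l₁ h₁ l₂ h₂ ∧ ((l₁ < l₂ ∧ h₂ ≤ h₁) ∨ (l₂ < l₁ ∧ h₁ ≤ h₂)) ∧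
        ∀ b, vecLaw M v b = atomLaw x T j l₁ h₁ l₂ h₂ b)) := by
  rcases hs with ⟨q, hq⟩ | ⟨l₁, h₁, l₂, h₂, hd, hv⟩
  · refine Or.inl ⟨q, Nat.lt_succ_iff.1 q.isLt, fun k hk1 hk2 hne => ?_⟩
    by_cases hkM : k < M + 1
    · rw [vecLaw_apply_of_lt v hkM] at hne
      exact hq ⟨k, hkM⟩ hk1 hk2 hne
    · exact absurd (by rw [vecLaw, dif_neg hkM]) hne
  · refine Or.inr ⟨l₁, h₁, l₂, h₂, hd.1, hd.2, fun b => ?_⟩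
    by_cases hbM : b < M + 1
    · rw [vecLaw_apply_of_lt v hbM]; exact hv ⟨b, hbM⟩
    · rw [vecLaw, dif_neg hbM]
      exact (atomLaw_eq_zero_of_gt x T j l₁ h₁ l₂ h₂ (Nat.lt_succ_iff.1 l₁.isLt) (Nat.lt_succ_iff.1 h₁.isLt)
        (Nat.lt_succ_iff.1 l₂.isLt) (Nat.lt_succ_iff.1 h₂.isLt) (not_lt.1 hbM |> fun h => by omega)).symm

/-- **THE SHAPE DECOMPOSITION OF A WINDOW-DEC LAW** (Krein–Milman + Carathéodory on the window polytope, as census-2 g57's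
`windowAtomDecomposition_of_extremeSmall`, with `windowExtreme_shape` in place of smallness): every window-DEC probability law on
`{0..M}` is a finite mixture of window-DEC probability laws each of which charges at most one low of the layer `j` or is a balanced
two-segment atom. [this work] -/
theorem windowShapeDecomposition (x T : ℝ) (M j w : ℕ) (μ : ℕ → ℝ) (hx0 : 0 < x) (hx1 : x < 1)
    (hμ0 : ∀ h, 0 ≤ μ h) (hμM : ∀ h, M < h → μ h = 0) (hμ1 : ∑ h ∈ Finset.range (M + 1), μ h = 1)
    (hwin : ∀ J, J ≤ j → j ≤ J + w → DECAtT x T J M μ) :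
    ∃ (ι : Type) (_ : Fintype ι) (wt : ι → ℝ) (ν : ι → ℕ → ℝ),
      (∀ i, 0 ≤ wt i) ∧ (∑ i, wt i = 1) ∧ (∀ h, μ h = ∑ i, wt i * ν i h) ∧
      (∀ i, 0 < wt i →
        (∀ h, 0 ≤ ν i h) ∧ (∀ h, M < h → ν i h = 0) ∧ (∑ h ∈ Finset.range (M + 1), ν i h = 1) ∧
        ((∃ q, q ≤ j ∧ ∀ k, k ≤ j → 2 * (k : ℝ) < T → ν i k ≠ 0 → k = q) ∨
          (∃ l₁ h₁ l₂ h₂, AtomData x T j M l₁ h₁ l₂ h₂ ∧ ((l₁ < l₂ ∧ h₂ ≤ h₁) ∨ (l₂ < l₁ ∧ h₁ ≤ h₂)) ∧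
            ∀ b, ν i b = atomLaw x T j l₁ h₁ l₂ h₂ b)) ∧
        (∀ J, J ≤ j → j ≤ J + w → DECAtT x T J M (ν i))) := by
  classical
  set P := windowSet x T M j w with hPdef
  let v : Fin (M + 1) → ℝ := fun i => μ i
  have hvμ : vecLaw M v = μ := vecLaw_restrict μ hμM
  have hv1 : ∑ i, v i = 1 := by
    have := sum_range_vecLaw v; rw [hvμ, hμ1] at this; exact this.symm
  have hvP : v ∈ P := ⟨fun i => hμ0 i, hv1, fun J hJ hJw => by rw [hvμ]; exact hwin J hJ hJw⟩
  have hPc : IsCompact P := isCompact_windowSet x T M j w hx0 hx1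
  have hPconv : Convex ℝ P := convex_windowSet x T M j w
  set S : Set (Fin (M + 1) → ℝ) := {v : Fin (M + 1) → ℝ | (∃ q : Fin (j + 1), ∀ k : Fin (M + 1), (k : ℕ) ≤ j → 2 * ((k : ℕ) : ℝ) < T → v k ≠ 0 → (k : ℕ) = q) ∨
        (∃ l₁ h₁ l₂ h₂ : Fin (M + 1), (AtomData x T j M l₁ h₁ l₂ h₂ ∧ ((l₁ < l₂ ∧ h₂ ≤ h₁) ∨ (l₂ < l₁ ∧ h₁ ≤ h₂))) ∧
          ∀ k : Fin (M + 1), v k = atomLaw x T j l₁ h₁ l₂ h₂ k)} with hS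
  set K := closure (P.extremePoints ℝ) with hK
  have hKP : K ⊆ P := closure_minimal extremePoints_subset hPc.isClosed
  have hKS : K ⊆ S :=
    closure_minimal (fun z hz => shapeVec_of_shape (windowExtreme_shapeOrd x T M j w z hx0 hx1 hz)) (isClosed_shapeVecSet x T M j)
  have hKc : IsCompact K := hPc.of_isClosed_subset isClosed_closure hKP
  have hvK : v ∈ convexHull ℝ K := by
    have h1 : v ∈ closure (convexHull ℝ (P.extremePoints ℝ)) := by
      rw [closure_convexHull_extremePoints hPc hPconv]; exact hvP
    exact closure_minimal (convexHull_mono subset_closure) hKc.convexHull_of_finiteDimensional.isClosed h1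
  obtain ⟨ι, hι, z, wt, hz, -, hwpos, hw1, hwv⟩ := eq_pos_convex_span_of_mem_convexHull hvK
  refine ⟨ι, hι, wt, fun i => vecLaw M (z i), fun i => (hwpos i).le, hw1, fun h => ?_, fun i _ => ?_⟩
  · show μ h = ∑ i, wt i * vecLaw M (z i) h
    by_cases hh : h < M + 1
    · have e1 := congrFun hwv ⟨h, hh⟩
      simp only [Finset.sum_apply, Pi.smul_apply, smul_eq_mul] at e1
      rw [← hvμ, vecLaw_apply_of_lt _ hh, ← e1]
      exact Finset.sum_congr rfl fun i _ => by rw [vecLaw_apply_of_lt _ hh]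
    · rw [hμM h (not_lt.1 fun hle => hh (Nat.lt_succ_of_le (Nat.lt_succ_iff.1 hle)))]
      symm
      exact Finset.sum_eq_zero fun i _ => by rw [vecLaw, dif_neg hh, mul_zero]
  · have hzi : z i ∈ K := hz ⟨i, rfl⟩
    obtain ⟨hnn, hsum, hdec⟩ := hKP hzi
    refine ⟨fun h => ?_, fun h hh => vecLaw_apply_of_gt _ hh,
      by show ∑ h ∈ Finset.range (M + 1), vecLaw M (z i) h = 1; rw [sum_range_vecLaw, hsum],
      shape_of_shapeVec (hKS hzi), hdec⟩
    show 0 ≤ vecLaw M (z i) h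
    by_cases hh : h < M + 1
    · rw [vecLaw_apply_of_lt _ hh]; exact hnn _
    · rw [vecLaw, dif_neg hh]

/-- **ONE CROSS TERM**: two window-DEC probability laws of known shape convolve to a DEC law — a factor with at most one low by
census-1 g20's `lconv_decAtT_of_window_singleLow`, a factor with a datum without light straddlers by the one-sided theorem, and two
balanced atoms without such data by `ConvClosedTAtoms`. [this work] -/
theorem lconv_decAtT_of_shapes (hA : ConvClosedTAtomsOrd) (x T₁ T₂ : ℝ) (M₁ M₂ j : ℕ) (ν ω : ℕ → ℝ) (hx0 : 0 < x) (hx1 : x < 1)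
    (hν0 : ∀ h, 0 ≤ ν h) (hνM : ∀ h, M₁ < h → ν h = 0) (hν1 : ∑ h ∈ Finset.range (M₁ + 1), ν h = 1)
    (hω0 : ∀ h, 0 ≤ ω h) (hωM : ∀ h, M₂ < h → ω h = 0) (hω1 : ∑ h ∈ Finset.range (M₂ + 1), ω h = 1)
    (hj : j < M₁ + M₂)
    (hwν : ∀ j'', j'' ≤ j → j ≤ j'' + M₂ → DECAtT x T₁ j'' M₁ ν)
    (hwω : ∀ j'', j'' ≤ j → j ≤ j'' + M₁ → DECAtT x T₂ j'' M₂ ω)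
    (hsν : (∃ q, q ≤ j ∧ ∀ k, k ≤ j → 2 * (k : ℝ) < T₁ → ν k ≠ 0 → k = q) ∨
      (∃ l₁ h₁ l₂ h₂, AtomData x T₁ j M₁ l₁ h₁ l₂ h₂ ∧ ((l₁ < l₂ ∧ h₂ ≤ h₁) ∨ (l₂ < l₁ ∧ h₁ ≤ h₂)) ∧
        ∀ b, ν b = atomLaw x T₁ j l₁ h₁ l₂ h₂ b))
    (hsω : (∃ q, q ≤ j ∧ ∀ k, k ≤ j → 2 * (k : ℝ) < T₂ → ω k ≠ 0 → k = q) ∨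
      (∃ l₁ h₁ l₂ h₂, AtomData x T₂ j M₂ l₁ h₁ l₂ h₂ ∧ ((l₁ < l₂ ∧ h₂ ≤ h₁) ∨ (l₂ < l₁ ∧ h₁ ≤ h₂)) ∧
        ∀ b, ω b = atomLaw x T₂ j l₁ h₁ l₂ h₂ b)) :
    DECAtT x (T₁ + T₂) j (M₁ + M₂) (lconv M₁ M₂ ν ω) := by
  classical
  rcases hsω with ⟨q, hqj, hq⟩ | ⟨l₂, h₂, l₂', h₂', hd₂, ho₂, hω⟩
  · -- the second factor has at most one low
    exact lconv_decAtT_of_window_singleLow x T₁ T₂ j M₁ M₂ q ν ω hx0 hx1 hν0 hνM hν1 hqj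
      (fun k hk1 hk2 hk3 => hq k hk1 hk2 (ne_of_gt hk3)) hwν hwω
  rcases hsν with ⟨q, hqj, hq⟩ | ⟨l₁, h₁, l₁', h₁', hd₁, ho₁, hν⟩
  · -- the first factor has at most one low: commute
    have h := lconv_decAtT_of_window_singleLow x T₂ T₁ j M₂ M₁ q ω ν hx0 hx1 hω0 hωM hω1 hqj
      (fun k hk1 hk2 hk3 => hq k hk1 hk2 (ne_of_gt hk3)) hwω hwν
    rw [add_comm T₂ T₁, add_comm M₂ M₁, ← lconv_comm] at h
    exact h
  -- two balanced atoms
  by_cases hb₂ : BDECAtT x T₂ j M₂ M₁ ω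
  · exact lconv_decAtT_of_window_bdecAtT' x T₁ T₂ j M₁ M₂ ν ω hx0 hx1 hν0 hνM hν1 hwν hb₂
  by_cases hb₁ : BDECAtT x T₁ j M₁ M₂ ν
  · exact lconv_decAtT_of_bdecAtT_window' x T₁ T₂ j M₁ M₂ ν ω hx0 hx1 hω0 hωM hω1 hb₁ hwω
  have eν : ν = atomLaw x T₁ j l₁ h₁ l₁' h₁' := funext hν
  have eω : ω = atomLaw x T₂ j l₂ h₂ l₂' h₂' := funext hω
  subst eν eω
  -- (O1): the straddle of the cheap segments kills the parallel order, leaving the crossed one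
  have hs₁ := (straddle_of_not_bdecAtT x T₁ j M₁ M₂ l₁ h₁ l₁' h₁' hx0 hx1 hd₁ hb₁).1
  have hs₂ := (straddle_of_not_bdecAtT x T₂ j M₂ M₁ l₂ h₂ l₂' h₂' hx0 hx1 hd₂ hb₂).1
  have hp₁ := not_parallel_of_window x T₁ j M₁ M₂ l₁ h₁ l₁' h₁' hx0 hx1 hd₁ hwν hs₁
  have hp₂ := not_parallel_of_window x T₂ j M₂ M₁ l₂ h₂ l₂' h₂' hx0 hx1 hd₂ hwω hs₂
  have ho₁' : l₁ < l₁' ∧ h₁' ≤ h₁ := ho₁.resolve_right hp₁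
  have ho₂' : l₂ < l₂' ∧ h₂' ≤ h₂ := ho₂.resolve_right hp₂
  exact hA x T₁ T₂ M₁ M₂ j l₁ h₁ l₁' h₁' l₂ h₂ l₂' h₂' hx0 hx1 hj hd₁ hd₂ ho₁'.1 ho₁'.2 ho₂'.1 ho₂'.2 hwν hwω hb₁ hb₂

/-- **`ConvClosedT` ⟸ `ConvClosedTAtoms`** — the convolution closure of window-DEC laws reduces to its explicit atom ⊗ atom residue:
decompose both factors by `windowShapeDecomposition`, expand by bilinearity (`lconv_decAtT_of_mixtures`), and treat every cross term by
`lconv_decAtT_of_shapes`. [this work] -/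
theorem convClosedT_of_atomPairsOrd (hA : ConvClosedTAtomsOrd) : ConvClosedT := by
  intro x T₁ T₂ M₁ M₂ j μ₁ μ₂ hx0 hx1 h10 h1M h11 h20 h2M h21 hj hw1 hw2
  obtain ⟨ι, hι, w, ν, hw0, hws, hμ₁, hν⟩ := windowShapeDecomposition x T₁ M₁ j M₂ μ₁ hx0 hx1 h10 h1M h11 hw1
  obtain ⟨κ, hκ, v, ω, hv0, hvs, hμ₂, hω⟩ := windowShapeDecomposition x T₂ M₂ j M₁ μ₂ hx0 hx1 h20 h2M h21 hw2
  refine lconv_decAtT_of_mixtures x _ j _ M₁ M₂ μ₁ μ₂ w ν v ω hw0 hws hμ₁ hv0 hvs hμ₂ fun i k hi hk => ?_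
  obtain ⟨a0, aM, a1, ash, awin⟩ := hν i hi
  obtain ⟨b0, bM, b1, bsh, bwin⟩ := hω k hk
  exact lconv_decAtT_of_shapes hA x T₁ T₂ M₁ M₂ j (ν i) (ω k) hx0 hx1 a0 aM a1 b0 bM b1 hj awin bwin ash bsh

/-- **`ConvClosedT` ⟸ `ConvClosedTAtoms`** (the unordered explicit residue, a fortiori). [this work] -/
theorem convClosedT_of_atomPairs (hA : ConvClosedTAtoms) : ConvClosedT :=
  convClosedT_of_atomPairsOrd (convClosedTAtomsOrd_of_atoms hA)

/-- **`ConvClosedTAtomsOrd` ∧ (III) ⟹ `SDECConvClosed`**. [this work] -/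
theorem sdecConvClosed_of_atomPairsOrd (hA : ConvClosedTAtomsOrd) (hIII : GatedConvEmptyFree) : SDECConvClosed :=
  sdecConvClosed_of_convClosedT_of_gatedConvEmptyFree (convClosedT_of_atomPairsOrd hA) hIII

/-- **`ConvClosedTAtoms` ∧ (III) ⟹ `SDECConvClosed`**. [this work] -/
theorem sdecConvClosed_of_atomPairs (hA : ConvClosedTAtoms) (hIII : GatedConvEmptyFree) : SDECConvClosed :=
  sdecConvClosed_of_convClosedT_of_gatedConvEmptyFree (convClosedT_of_atomPairs hA) hIII

/-- **`ConvClosedTAtoms` ∧ (III) ⟹ `TreeBuiltDEC`**. [this work] -/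
theorem treeBuiltDEC_of_atomPairs (hA : ConvClosedTAtoms) (hIII : GatedConvEmptyFree) : TreeBuiltDEC :=
  treeBuiltDEC_of_sdecConvClosed (sdecConvClosed_of_atomPairs hA hIII)

/-- **the old residue statement implies the new one**: a balanced atom is a small law, so `ConvClosedTResidue ⟹ ConvClosedTAtoms` — the
explicit family is a genuine weakening of the hypothesis of record. [this work] -/
theorem convClosedTAtoms_of_residue (hR : ConvClosedTResidue) : ConvClosedTAtoms := by
  intro x T₁ T₂ M₁ M₂ j l₁ h₁ l₁' h₁' l₂ h₂ l₂' h₂' hx0 hx1 hj hd₁ hd₂ hw₁ hw₂ hb₁ hb₂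
  -- the atoms are small probability laws
  have small : ∀ (T : ℝ) (M l h l' h' : ℕ), AtomData x T j M l h l' h' →
      (∀ b, 0 ≤ atomLaw x T j l h l' h' b) ∧ (∀ b, M < b → atomLaw x T j l h l' h' b = 0) ∧
      (∑ b ∈ Finset.range (M + 1), atomLaw x T j l h l' h' b = 1) ∧ SmallLaw T j M (atomLaw x T j l h l' h') := by
    intro T M l h l' h' hd
    obtain ⟨hl1, hl2⟩ := hd.lt_of
    obtain ⟨a1, a2, a3, a4, a5, b1, b2, b3, b4, b5, hne, c2, c1⟩ := hd
    have hc₂ : 0 ≤ usage x T j l' h' := (usage_pos_of_compat x T j l' h' hx0 hx1 b2 hl2 (Or.inr b5)).le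
    have hcc : usage x T j l h ≠ usage x T j l' h' := ne_of_gt (c2.trans c1)
    refine ⟨atomLaw_nonneg x T j l h l' h' hx1 hc₂ c2 c1, fun b hb => atomLaw_eq_zero_of_gt x T j l h l' h' (by omega) a4 (by omega) b4 hb,
      sum_range_atomLaw x T j l h l' h' hx1 hcc (by omega) a4 (by omega) b4, ?_⟩
    refine ⟨l, l', h, h', a4, b4, Or.inl (by linarith), Or.inl (by linarith), fun k hk => ?_⟩
    by_contra hn; push Not at hn
    exact hk (atomLaw_eq_zero x T j l h l' h' hn.1 hn.2.2.1 hn.2.1 hn.2.2.2)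
  obtain ⟨n1, z1, s1, sm1⟩ := small T₁ M₁ l₁ h₁ l₁' h₁' hd₁
  obtain ⟨n2, z2, s2, sm2⟩ := small T₂ M₂ l₂ h₂ l₂' h₂' hd₂
  exact hR x T₁ T₂ M₁ M₂ j _ _ hx0 hx1 n1 z1 s1 n2 z2 s2 hj hw₁ hw₂ sm1 sm2 hb₁ hb₂

end Reduction

end LawDec

/-- **`ConvClosedTAtoms` ∧ (III) ⟹ `Quant.TreeDEC`**. [this work] -/
theorem treeDEC_of_atomPairs (hA : LawDec.ConvClosedTAtoms) (hIII : LawDec.GatedConvEmptyFree) : TreeDEC :=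
  treeDEC_of_sdecConvClosed (LawDec.sdecConvClosed_of_atomPairs hA hIII)

/-- **`ConvClosedTAtomsOrd` ∧ (III) ⟹ `Quant.FarTreeRow`** — FAR on trees from the ORDERED explicit atom ⊗ atom statement and Conjecture E;
the weakest law-level hypothesis of this lane so far.  CONDITIONAL: both hypotheses are `@[conjecture]`. [this work] -/
theorem farTreeRow_of_atomPairsOrd (hA : LawDec.ConvClosedTAtomsOrd) (hIII : LawDec.GatedConvEmptyFree) : FarTreeRow :=
  farTreeRow_of_sdecConvClosed (LawDec.sdecConvClosed_of_atomPairsOrd hA hIII)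

/-- **`ConvClosedTAtoms` ∧ (III) ⟹ `Quant.FarTreeRow`** — FAR on trees from the explicit atom ⊗ atom statement and Conjecture E.
CONDITIONAL: both hypotheses are `@[conjecture]`. [this work] -/
theorem farTreeRow_of_atomPairs (hA : LawDec.ConvClosedTAtoms) (hIII : LawDec.GatedConvEmptyFree) : FarTreeRow :=
  farTreeRow_of_sdecConvClosed (LawDec.sdecConvClosed_of_atomPairs hA hIII)

end Quant

end Summit.CriticalPhenomena.PercolationContinuityZ3.Theorems
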